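import Literature.NumberTheory.LFunctions.WeilMellinPolyDecay
import Literature.NumberTheory.LFunctions.WeilDilationVirial
import HarnessLib

/-!
# Calculus of the Weil transform on the critical line

Small complements to `WeilMellinInversion.lean` / `WeilMellinPolyDecay.lean` for the transform
`ĝ(s) = ∫ g(t) e^{(s-1/2)t} dt` (`Literature.NumberTheory.LFunctions.weilMellin`) restricted to
the critical line `s = 1/2 + iτ`, where it is the Fourier transform `ĝ(1/2+iτ) = ∫ g(x) e^{ixτ} dx`
(`weilMellin_half_eq_integral`): the `τ`-derivative is the transform of `ix·g(x)`
(`hasDerivAt_weilMellin_vertical`), multiplication by `ix` preserves test functions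
(`IsWeilTest.I_mul`, via `IsWeilTest.ofReal_mul` of `WeilDilationVirial.lean`), decay bounds in the forms `D/(1+τ²)` and `D/(1+τ²)²`, the support of
the even part `g(x) + g(-x)`, and the symmetrisation `∫ (g(x)+g(-x)) Ψ(x) dx = ∫ g(x)(Ψ(x)+Ψ(-x)) dx`.
All folklore and proved; no named facts.
-/

noncomputable section

open Complex Filter Set MeasureTheory
open scoped Real Topology ContDiff

namespace Literature.NumberTheory.LFunctions

variable {g : ℝ → ℂ}

/-- On the critical line `ĝ(1/2 + iτ) = ∫ g(x) e^{ixτ} dx`. [folklore] -/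
theorem weilMellin_half_eq_integral (g : ℝ → ℂ) (τ : ℝ) :
    weilMellin g (1 / 2 + τ * I) = ∫ x : ℝ, g x * cexp (((x * τ : ℝ) : ℂ) * I) := by
  unfold weilMellin
  congr 1 with x
  congr 2
  push_cast
  ring

/-- `ĝ(1/2 + i(-τ)) = ĝ(1/2 - iτ)`. [folklore] -/
theorem weilMellin_half_neg (g : ℝ → ℂ) (τ : ℝ) :
    weilMellin g (1 / 2 + ((-τ : ℝ) : ℂ) * I) = weilMellin g (1 / 2 - τ * I) := by
  congr 1; push_cast; ring

/-- `(g(-·))^(1/2 + iτ) = ĝ(1/2 - iτ)`. [folklore] -/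
theorem weilMellin_comp_neg_half (g : ℝ → ℂ) (τ : ℝ) :
    weilMellin (fun t ↦ g (-t)) (1 / 2 + τ * I) = weilMellin g (1 / 2 - τ * I) := by
  rw [weilMellin_comp_neg]; congr 1; ring

/-- Multiplication by `ix` preserves test functions. [folklore] -/
theorem IsWeilTest.I_mul (hg : IsWeilTest g) : IsWeilTest fun x : ℝ ↦ I * x * g x := by
  have := (hg.ofReal_mul).const_mul I
  simpa [mul_assoc] using this

/-- **The `τ`-derivative on the critical line**: `d/dτ ĝ(1/2+iτ) = (ix·g)^(1/2+iτ)`, for `g`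
continuous of compact support. [folklore] -/
theorem hasDerivAt_weilMellin_vertical (hg : Continuous g) (hg' : HasCompactSupport g) (τ : ℝ) :
    HasDerivAt (fun τ : ℝ ↦ weilMellin g (1 / 2 + τ * I))
      (weilMellin (fun x : ℝ ↦ I * x * g x) (1 / 2 + τ * I)) τ := by
  have h1 : HasDerivAt (fun τ : ℝ ↦ (1 / 2 : ℂ) + τ * I) I τ := by
    have := ((hasDerivAt_id τ).ofReal_comp.mul_const I).const_add (1 / 2 : ℂ)
    simpa using this
  have h2 := (hasDerivAt_weilMellin hg hg' (1 / 2 + τ * I)).comp τ h1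
  refine h2.congr_deriv ?_
  unfold weilMellin
  rw [← integral_mul_const]
  congr 1 with x
  ring

/-- Continuity of `τ ↦ ĝ(1/2+iτ)` written as a Fourier integral. [folklore] -/
theorem continuous_weilMellin_half_integral (hg : Continuous g) (hg' : HasCompactSupport g) :
    Continuous fun τ : ℝ ↦ ∫ x : ℝ, g x * cexp (((x * τ : ℝ) : ℂ) * I) := by
  have := continuous_weilMellin_vertical hg hg' (1 / 2)
  simp_rw [show ((1 / 2 : ℝ) : ℂ) = 1 / 2 by push_cast; ring, weilMellin_half_eq_integral] at this
  exact this

/-- Decay `‖ĝ(1/2+iτ)‖ ≤ D/(1+τ²)`, in Fourier-integral form. [folklore] -/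
theorem exists_norm_weilMellin_half_le (hg : IsWeilTest g) :
    ∃ D : ℝ, ∀ τ : ℝ, ‖∫ x : ℝ, g x * cexp (((x * τ : ℝ) : ℂ) * I)‖ ≤ D / (1 + τ ^ 2) := by
  refine ⟨weilDecayW |(1 / 2 : ℝ) - 1 / 2| g, fun τ => ?_⟩
  have h := norm_weilMellin_vertical_le hg (1 / 2) τ
  rw [← weilMellin_half_eq_integral]
  have e : ((1 / 2 : ℝ) : ℂ) = 1 / 2 := by push_cast; ring
  rw [e] at h
  simpa [div_eq_mul_inv] using h

/-- Decay `‖ĝ(1/2+iτ)‖ ≤ D/(1+τ²)²`. [folklore] -/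
theorem exists_norm_weilMellin_half_le_sq (hg : IsWeilTest g) :
    ∃ D : ℝ, ∀ τ : ℝ, ‖weilMellin g (1 / 2 + τ * I)‖ ≤ D / (1 + τ ^ 2) ^ 2 := by
  obtain ⟨D, _, hD⟩ := norm_weilMellin_le_pow_of_abs_re_le hg 0 2
  refine ⟨D, fun τ => ?_⟩
  have := hD (1 / 2 + τ * I) (by simp)
  simpa using this

/-- The even part `x ↦ g(x) + g(-x)` of a function supported in `[-a, a]` is supported in
`[-a, a]`. [folklore] -/
theorem tsupport_add_comp_neg_subset {a : ℝ} (hgs : tsupport g ⊆ Icc (-a) a) :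
    tsupport (fun x ↦ g x + g (-x)) ⊆ Icc (-a) a := by
  refine closure_minimal (fun x hx => ?_) isClosed_Icc
  rw [Function.mem_support] at hx
  by_contra h
  have h1 : g x = 0 := image_eq_zero_of_notMem_tsupport fun h' => h (hgs h')
  have h2 : g (-x) = 0 := by
    refine image_eq_zero_of_notMem_tsupport fun h' => h ?_
    have := hgs h'
    simp only [mem_Icc] at this ⊢
    constructor <;> linarith [this.1, this.2]
  exact hx (by rw [h1, h2, add_zero])

/-- Multiplying by a function does not enlarge the support bound. [folklore] -/
theorem tsupport_mul_subset_of_subset {S : Set ℝ} (c : ℝ → ℂ) (hgs : tsupport g ⊆ S) :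
    tsupport (fun x ↦ c x * g x) ⊆ S :=
  (tsupport_mul_subset_right (f := c) (g := g)).trans hgs

/-- **Symmetrisation**: `∫ (g(x) + g(-x)) Ψ(x) dx = ∫ g(x) (Ψ(x) + Ψ(-x)) dx` for `g` continuous of
compact support and `Ψ` continuous. [folklore] -/
theorem integral_add_comp_neg_mul (hg : Continuous g) (hg' : HasCompactSupport g) {Ψ : ℝ → ℂ}
    (hΨ : Continuous Ψ) :
    ∫ x : ℝ, (g x + g (-x)) * Ψ x = ∫ x : ℝ, g x * (Ψ x + Ψ (-x)) := by
  have hgn : Continuous fun x : ℝ ↦ g (-x) := hg.comp continuous_neg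
  have hgn' : HasCompactSupport fun x : ℝ ↦ g (-x) := hg'.comp_homeomorph (Homeomorph.neg ℝ)
  have i1 : Integrable fun x : ℝ ↦ g x * Ψ x := (hg.mul hΨ).integrable_of_hasCompactSupport hg'.mul_right
  have i2 : Integrable fun x : ℝ ↦ g (-x) * Ψ x :=
    (hgn.mul hΨ).integrable_of_hasCompactSupport hgn'.mul_right
  have i3 : Integrable fun x : ℝ ↦ g x * Ψ (-x) :=
    (hg.mul (hΨ.comp continuous_neg)).integrable_of_hasCompactSupport hg'.mul_right
  have h2 : ∫ x : ℝ, g (-x) * Ψ x = ∫ x : ℝ, g x * Ψ (-x) := by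
    have h := integral_neg_eq_self (fun x : ℝ ↦ g x * Ψ (-x)) volume
    rw [← h]
    simp
  simp_rw [add_mul, mul_add]
  rw [integral_add i1 i2, integral_add i1 i3, h2]

end Literature.NumberTheory.LFunctions
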